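import Summits.QuantumFields.BalabanUV.Beta.FP.ConstrainedGhostIRCoarse

/-!
# `BalabanUV.Beta.FP.ConstrainedGhostIRSecond` — road «FP» for binder row D1, row H′2-IR ∕ IR-4a (owner rulings l.21173 (γ), R-FP-20, R-FP-21 (A2)):
# SECOND x-DIFFERENCES OF THE CONSTRAINED GHOST's WOODBURY REMAINDER — (T2-sup) from a displayed degree-4 letter (which legitimately carries the
# block-edge `log N`), and the LOG-FREE TRACE CHANNEL (T2-trace) `|Σ_κ Δ_κ⁺Δ_κ⁻ ghostRem N (·,x′)| = |Ws(quo N x, x′)| ≤ K·N⁻⁴` in SUP form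

HONEST DEPENDENCY (page 1, mandatory): continuum YM on T⁴ ⇐ BetaPertH ∧ nine spine estimates (0/9 proved); BetaPertH ⇐ (D1) ∧ (D4) ∧
CAP+tail; G-an2-4 gates asym, D1 and NE2/3/4.  HONEST FRAMING (cell contract, verbatim): «discharging `BetaPertH` makes Bałaban's UV
stability UNCONDITIONAL — a real constructive-QFT result; it is NOT the continuum limit and NOT the Clay problem.»  THIS MODULE is [folklore]
lattice power counting over leaf-06's `FP/ConstrainedGhost` (`ghostRem_eq_tsum`, `lapN_ghostRem`, `summable_bdd_mul_Ws`) and `FP/ConstrainedGhostIR`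
(`abs_tsum_mul_le_of_profiles`) and leaf-05-g9's `FP/ConstrainedGhostIRCoarse` (`abs_Ws_le_of_coarseInv`) BY NAME; every analytic input is a
DISPLAYED HYPOTHESIS with its supplier named; no `def`, no `def … : Prop`, nothing cited, 0 sorry; proves NO estimate of a Bałaban object
unconditionally.  0∕4 binders of row D1; NOT D1, NOT BetaPertH, NOT continuum, NOT Clay.

ABSOLUTE RULE (cell charter, verbatim): «No internally-minted statement may enter as a cited fact. Every hypothesis is either kernel-proved in
this package or a verbatim quotation of a PUBLISHED theorem with page reference. The manuscript(s) under audit are NOT citable for their own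
disputed steps — they are the thing under adjudication; programme-internal (2001/route/tribunal) claims are never citable.»

WHY TWO FORMS (owner (γ) l.21173 ∕ R-FP-20, after gan24-formalise-leaf-04-g39's located EDGE LOGARITHM): the mixed second differences of the
block potential `G₀ ∗ 𝟙_B` are `log N`-unbounded at points adjacent to the block's codimension-2 edges, and the x-second-differences of
`ghostRem = Σ'_u A(x,u)·Ws(u,x′)` fall exactly on `A(x,u) = blockSum N (G₀(x − ·)) u`; so a log-free GLOBAL sup bound `|ΔΔ ghostRem| ≤ K·N⁻⁴` is
«NOT THIS SHAPE».  What holds: (T2-sup) with whatever constant the degree-4 letter (S″) carries (its supplier, IR-1-GEN's marginal profile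
`BlockAveragedKernelDipole.abs_blockSum_le_profile_marginal`, gives `A″ ≍ A₂·(97 + 64·log 3N)`), and — LOG-FREE — the TRACE channel, because
`−Σ_κ Δ_κ⁺Δ_κ⁻ ghostRem N (·,x′) = codiff₁ (dz ·) = Ws(quo N ·, x′)` is BLOCK-CONSTANT (leaf-06's `lapN_ghostRem`): its sup IS its block average.
CONTENT. §1 `trace_secondDiff_eq_neg_codiff_dz` (the finite-difference identity), **`abs_trace_secondDiff_ghostRem_le_of_W`** ((T2-trace) from the
(W) letter: `≤ K·N⁻⁴`), **`abs_secondDiff_ghostRem_le_of_letters`** ((T2-sup) from (S″) + (W): `≤ 162·A″·K·N⁻⁴`); §2 the same two UNDER (H-CINV) via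
`ConstrainedGhostIRCoarse.abs_Ws_le_of_coarseInv` (`K = 1296κa₂N⁶ + 1`, N-free at `κ = c₀N⁻⁶`).  (T2-win) (the windowed-ℓ¹, log-free consumer letter
of H′3) needs the windowed (D2) letter and follows in the letters-instance file.
Provenance: D1 formalisation swarm, unit b2b-balaban-beta-d1-formalise-leaf-05 gen 9 (prover-b2b-balaban-beta-d1-formalise-leaf-05-g9-0),
2026-08-20; `LEAVES-FP.md` row H′2-IR ∕ IR-4a.  [folklore], 0 def, 0 cite, 0 sorry.
-/

namespace Summit.QuantumFields.BalabanUV.Beta.FP.ConstrainedGhostIRSecond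

open Finset
open scoped BigOperators
open Literature.Probability.LatticeModels (latticeGreen)
open Literature.MathematicalPhysics.QuantumFieldTheory.Balaban1983to89.Beta
open AffineAveraging (box toSite blockSum unitVec dz codiff₁)
open Literature.MathematicalPhysics.QuantumFieldTheory.LatticeForm (quo)
open ScalarBlockKKT (Ws)
open Literature.MathematicalPhysics.QuantumFieldTheory.Balaban1983to89.Beta.DyadicShell (Pt supNorm)
open Summit.QuantumFields.BalabanUV.Beta.FP.ConstrainedGhost (ghostRem ghostRem_eq_tsum lapN_ghostRem abs_blockSum_free_le summable_bdd_mul_Ws)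
open Summit.QuantumFields.BalabanUV.Beta.FP.ConstrainedGhostIR (abs_tsum_mul_le_of_profiles)
open Summit.QuantumFields.BalabanUV.Beta.FP.LatticeConvolutionBounds (one_le_supNorm_add_one)
open Summit.QuantumFields.BalabanUV.Beta.FP.ConstrainedGhostIRCoarse (abs_Ws_le_of_coarseInv)

variable {N : ℕ} [NeZero N]

/-! ## §1 From letters -/

omit [NeZero N] in
/-- [folklore] The TRACE of the symmetric second differences is minus an2's `codiff₁ ∘ dz`:
`Σ_κ (f(x+e_κ) − 2 f(x) + f(x−e_κ)) = −codiff₁ (dz f) x`. -/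
theorem trace_secondDiff_eq_neg_codiff_dz (f : AffineAveraging.Site (3 + 1) → ℝ) (x : AffineAveraging.Site (3 + 1)) :
    ∑ κ : Fin (3 + 1), (f (x + unitVec κ) - 2 * f x + f (x - unitVec κ)) = -codiff₁ (dz f) x := by
  simp only [AffineAveraging.codiff₁, AffineAveraging.dz, sub_add_cancel, ← Finset.sum_neg_distrib]
  refine Finset.sum_congr rfl fun κ _ => ?_
  ring

/-- [folklore] **(T2-trace) FROM THE (W) LETTER — LOG-FREE, SUP FORM**: `|Σ_κ (ghostRem N (x+e_κ) x′ − 2·ghostRem N x x′ + ghostRem N (x−e_κ) x′)| ≤ K·N⁻⁴`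
for ALL `x, x′` — the trace is `−Ws(quo N x, x′)` (`lapN_ghostRem`), block-constant in `x`. -/
theorem abs_trace_secondDiff_ghostRem_le_of_W {K : ℝ} {b : ℕ}
    (hW : ∀ y x' : Pt, |Ws (d := 3) (N := N) y x'| ≤ K * ((N : ℝ) ^ 4)⁻¹ * (((supNorm (y - quo N x') : ℝ) + 1) ^ b)⁻¹)
    (x x' : Pt) :
    |∑ κ : Fin (3 + 1), (ghostRem (d := 3) N (x + unitVec κ) x' - 2 * ghostRem (d := 3) N x x' + ghostRem (d := 3) N (x - unitVec κ) x')|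
      ≤ K * ((N : ℝ) ^ 4)⁻¹ := by
  rw [trace_secondDiff_eq_neg_codiff_dz (fun z => ghostRem (d := 3) N z x') x, abs_neg, lapN_ghostRem (N := N) (by norm_num) x' x]
  have h := hW (quo N x) x'
  have hK : 0 ≤ K * ((N : ℝ) ^ 4)⁻¹ := by
    have h1 := (abs_nonneg _).trans h
    have hφ : 0 < (((supNorm (quo N x - quo N x') : ℝ) + 1) ^ b)⁻¹ := by positivity
    nlinarith
  refine h.trans ?_
  have hφ1 : (((supNorm (quo N x - quo N x') : ℝ) + 1) ^ b)⁻¹ ≤ 1 :=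
    inv_le_one_of_one_le₀ (one_le_pow₀ (one_le_supNorm_add_one _))
  calc K * ((N : ℝ) ^ 4)⁻¹ * (((supNorm (quo N x - quo N x') : ℝ) + 1) ^ b)⁻¹ ≤ K * ((N : ℝ) ^ 4)⁻¹ * 1 :=
        mul_le_mul_of_nonneg_left hφ1 hK
    _ = K * ((N : ℝ) ^ 4)⁻¹ := mul_one _

/-- [folklore] **(T2-sup) FROM LETTERS**: a degree-4 letter (S″) for the second `(e, e′)`-difference of the free-leg block column (its constant `A″` carries
whatever the supplier gives — the block-edge `log N` in sup norm, R-FP-20) and the (W) letter ⟹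
`|ghostRem N (x+e+e′) x′ − ghostRem N (x+e) x′ − ghostRem N (x+e′) x′ + ghostRem N x x′| ≤ 162·A″·K·N⁻⁴` for ALL `x, x′`. -/
theorem abs_secondDiff_ghostRem_le_of_letters {A'' K : ℝ} {b : ℕ} (hb : 1 ≤ b) (e e' : Pt)
    (hS'' : ∀ x y : Pt, |blockSum N (fun z => latticeGreen (x + e + e' - z) / 2) y - blockSum N (fun z => latticeGreen (x + e - z) / 2) y
        - blockSum N (fun z => latticeGreen (x + e' - z) / 2) y + blockSum N (fun z => latticeGreen (x - z) / 2) y|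
      ≤ A'' * (((supNorm (y - quo N x) : ℝ) + 1) ^ 4)⁻¹)
    (hW : ∀ y x' : Pt, |Ws (d := 3) (N := N) y x'| ≤ K * ((N : ℝ) ^ 4)⁻¹ * (((supNorm (y - quo N x') : ℝ) + 1) ^ b)⁻¹)
    (x x' : Pt) :
    |ghostRem (d := 3) N (x + e + e') x' - ghostRem (d := 3) N (x + e) x' - ghostRem (d := 3) N (x + e') x' + ghostRem (d := 3) N x x'|
      ≤ 162 * A'' * K * ((N : ℝ) ^ 4)⁻¹ := by
  have hs : ∀ p : Pt, Summable fun y => blockSum N (fun z => latticeGreen (p - z) / 2) y * Ws (d := 3) (N := N) y x' :=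
    fun p => summable_bdd_mul_Ws (fun y => abs_blockSum_free_le (by norm_num) p y) x'
  rw [ghostRem_eq_tsum (by norm_num) (x + e + e') x', ghostRem_eq_tsum (by norm_num) (x + e) x', ghostRem_eq_tsum (by norm_num) (x + e') x',
    ghostRem_eq_tsum (by norm_num) x x', ← (hs (x + e + e')).tsum_sub (hs (x + e)), ← ((hs (x + e + e')).sub (hs (x + e))).tsum_sub (hs (x + e')),
    ← (((hs (x + e + e')).sub (hs (x + e))).sub (hs (x + e'))).tsum_add (hs x)]
  simp only [← sub_mul, ← add_mul]
  have h := (abs_tsum_mul_le_of_profiles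
    (S := fun y => blockSum N (fun z => latticeGreen (x + e + e' - z) / 2) y - blockSum N (fun z => latticeGreen (x + e - z) / 2) y
        - blockSum N (fun z => latticeGreen (x + e' - z) / 2) y + blockSum N (fun z => latticeGreen (x - z) / 2) y)
    (W := fun y => Ws (d := 3) (N := N) y x') (p := 4) (q := b) (by omega) (quo N x) (quo N x') (fun y => hS'' x y) (fun y => hW y x')).2
  calc |∑' y, (blockSum N (fun z => latticeGreen (x + e + e' - z) / 2) y - blockSum N (fun z => latticeGreen (x + e - z) / 2) y
          - blockSum N (fun z => latticeGreen (x + e' - z) / 2) y + blockSum N (fun z => latticeGreen (x - z) / 2) y) * Ws (d := 3) (N := N) y x'|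
      ≤ 162 * A'' * (K * ((N : ℝ) ^ 4)⁻¹) := h
    _ = 162 * A'' * K * ((N : ℝ) ^ 4)⁻¹ := by ring

/-! ## §2 Under (H-CINV): the (W) letter from `ConstrainedGhostIRCoarse` -/

/-- [folklore] **(T2-trace) UNDER (H-CINV)** — LOG-FREE: `|Σ_κ (ghostRem N (x+e_κ) x′ − 2·ghostRem N x x′ + ghostRem N (x−e_κ) x′)| ≤ (1296κa₂N⁶ + 1)·N⁻⁴`
(`= (1296c₀a₂ + 1)·N⁻⁴` at IR-4b's `κ = c₀N⁻⁶`). -/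
theorem abs_trace_secondDiff_ghostRem_le_of_coarseInv (C : AffineAveraging.Site (3 + 1) → AffineAveraging.Site (3 + 1) → ℝ) {κ a₂ : ℝ}
    (hN : 1 ≤ N) (hC : ∀ u v, |C u v| ≤ κ / ((supNorm (u - v) : ℝ) + 1) ^ 5)
    (hCM : ∀ u w, HasSum (fun v => C u v * ∑ b ∈ box (3 + 1) N, blockSum N (fun z => latticeGreen ((N : ℤ) • v + toSite b - z) / 2) w)
      (if u = w then 1 else 0))
    (hAosc : ∀ x y v : AffineAveraging.Site (3 + 1), quo N x = quo N y →
      |blockSum N (fun z => latticeGreen (x - z) / 2) v - blockSum N (fun z => latticeGreen (y - z) / 2) v|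
        ≤ a₂ * (N : ℝ) ^ 2 / ((supNorm (quo N x - v) : ℝ) + 1) ^ 3)
    (x x' : Pt) :
    |∑ κ : Fin (3 + 1), (ghostRem (d := 3) N (x + unitVec κ) x' - 2 * ghostRem (d := 3) N x x' + ghostRem (d := 3) N (x - unitVec κ) x')|
      ≤ (1296 * κ * a₂ * (N : ℝ) ^ 6 + 1) * ((N : ℝ) ^ 4)⁻¹ :=
  abs_trace_secondDiff_ghostRem_le_of_W (b := 3) (abs_Ws_le_of_coarseInv C hN hC hCM hAosc) x x'

/-- [folklore] **(T2-sup) UNDER (H-CINV)**: (S″) + (L1′) + (H-CINV) ⟹ the second `(e,e′)`-difference of `ghostRem N (·) x′` is `≤ 162·A″·(1296κa₂N⁶ + 1)·N⁻⁴`. -/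
theorem abs_secondDiff_ghostRem_le_of_coarseInv (C : AffineAveraging.Site (3 + 1) → AffineAveraging.Site (3 + 1) → ℝ) {κ a₂ A'' : ℝ}
    (hN : 1 ≤ N) (hC : ∀ u v, |C u v| ≤ κ / ((supNorm (u - v) : ℝ) + 1) ^ 5)
    (hCM : ∀ u w, HasSum (fun v => C u v * ∑ b ∈ box (3 + 1) N, blockSum N (fun z => latticeGreen ((N : ℤ) • v + toSite b - z) / 2) w)
      (if u = w then 1 else 0))
    (hAosc : ∀ x y v : AffineAveraging.Site (3 + 1), quo N x = quo N y →
      |blockSum N (fun z => latticeGreen (x - z) / 2) v - blockSum N (fun z => latticeGreen (y - z) / 2) v|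
        ≤ a₂ * (N : ℝ) ^ 2 / ((supNorm (quo N x - v) : ℝ) + 1) ^ 3)
    (e e' : Pt)
    (hS'' : ∀ x y : Pt, |blockSum N (fun z => latticeGreen (x + e + e' - z) / 2) y - blockSum N (fun z => latticeGreen (x + e - z) / 2) y
        - blockSum N (fun z => latticeGreen (x + e' - z) / 2) y + blockSum N (fun z => latticeGreen (x - z) / 2) y|
      ≤ A'' * (((supNorm (y - quo N x) : ℝ) + 1) ^ 4)⁻¹)
    (x x' : Pt) :
    |ghostRem (d := 3) N (x + e + e') x' - ghostRem (d := 3) N (x + e) x' - ghostRem (d := 3) N (x + e') x' + ghostRem (d := 3) N x x'|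
      ≤ 162 * A'' * (1296 * κ * a₂ * (N : ℝ) ^ 6 + 1) * ((N : ℝ) ^ 4)⁻¹ :=
  abs_secondDiff_ghostRem_le_of_letters (by norm_num : 1 ≤ 3) e e' hS'' (abs_Ws_le_of_coarseInv C hN hC hCM hAosc) x x'

end Summit.QuantumFields.BalabanUV.Beta.FP.ConstrainedGhostIRSecond
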